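import Literature.MathematicalPhysics.QuantumFieldTheory.Balaban1983to89.B15Prop1RealChartFamilyAtGauge
import Literature.MathematicalPhysics.QuantumFieldTheory.Balaban1983to89.B15Prop1RealChartFamilyVelocityB
import Literature.MathematicalPhysics.QuantumFieldTheory.Balaban1983to89.B15Prop1RealChartFamilySupportB
import Literature.MathematicalPhysics.QuantumFieldTheory.Balaban1983to89.B15Prop1RealChartFamilyGaugeTransportB

/-!
# `Balaban1983to89.B15Prop1RealChartFamilyAtGaugeB` — [Balaban1985Variational] = «[15]», (3)–(4) p. 278, (15) p. 280, (172) p. 305, (181) p. 307, Prop. 9 (190) p. 309;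
# [Balaban1989LargeFieldII] = «[LF-II]», p. 357, (1.12) p. 359; [Balaban1988Convergent] = «[III]», (2.2) p. 255, (2.11)–(2.13) pp. 256–257; [Balaban1984PropagatorsII] = «[II]»,
# (2.3) p. 224 (the BOND-level determining datum):
# ★★★ THE (K′) PACKAGE AT ANY RESIDUAL GAUGE OF THE BASE MINIMISER OVER A BOND-DATUM FAMILY `bd` — print-datum ([II] (2.3)) edition of dag-n12-w5's
# `B15Prop1RealChartFamilyAtGauge.exists_realChartFamily_atGauge_atRecord` (the one datum-bearing declaration N12's junction of record v14ᴸ uses from that module) —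
# class (γ)∕(β) of dag-n12-c's census-by-declaration v2 (bus [DAGN12C-G35], 2026-08-30)

Honest framing: statement-level skeleton of published theorems with citation tags; proofs where landed; nothing here is a claim about the
Yang–Mills mass gap.  Cell `pub-ymgap`, seat `pub-ymgap-dag-n12-c` (g35; LANE OWNER N12 = [B15], strategy s1); count-neutral helper of K1⁹ (`stmt-QuantumFields-27364`);
N12 NOT discharged; finite 𝕋⁴ at fixed ε; nothing continuum ∕ OS ∕ mass-gap ∕ Clay.

WHY A SEPARATE EDITION (the (E1)(iii-b) re-attachment, director-ym №338–№358).  The parent composes, at the tree's site-level determining set `𝐁_k(Z) = Bj ν.M₁ Z k`, the three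
(K′) producers `B15Prop1RealChartFamilyVelocity.exists_realChartFamily_hval_velocity_atRecord` (family + (K)), `B15Prop1RealChartFamilyGaugeTransport.realChartFamily_gaugeAct_atRecord`
(transport to `σ • U₀`) and `B15Prop1RealChartFamilySupport.support_realChartFamily_atRecord` (support).  Over print's [II] (2.3) BOND-level datum the three producers are the lane's
twins `B15Prop1RealChartFamilyVelocityB.exists_realChartFamily_hval_velocity_atRecordB` (over a bond-datum family `bd : ℕ → (ℕ → Set (Site P 0)) → BDetSet P`, datum
`bd k (maxDomT ν.M₁ Z)`), `B15Prop1RealChartFamilyGaugeTransportB.realChartFamily_gaugeAct_atRecord` (over any `𝔅` empty above level `k`) and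
`B15Prop1RealChartFamilySupportB.support_realChartFamily_atRecord` (over any `𝔅` and a DISPLAYED support set `S` with the letters `hS : ∀ b ∉ S, b ∈ 𝔅 0`, `hfar`); this module
composes them binder for binder.  RE-KEY NOTE for the junction's generator (dag-n12-d): the binder `hk0 : 0 < k` is GONE; new binders `(bd)` (before `Z Λ`), `(hbd : ∀ j, k < j →
bd k (maxDomT ν.M₁ Z) j = ∅)`, and `(S) (hS)` before `hfar`; `hfar` and the two support conclusions read `b ∉ S` where the parent read `b.src ∉ maxDomT ν.M₁ Z 1`; the residual
root letter `hu` reads `∀ b ∈ bd k (maxDomT ν.M₁ Z) j` where the parent read `∀ b ∈ bondsOf (Bj ν.M₁ Z k j)`.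

CONTENTS (theorems only; no `def`, no `instance`, no `sorry`; namespace `…B15Prop1RealChartFamilyAtGaugeB`, SAME declaration name as the parent).
* ★★★ `exists_realChartFamily_atGauge_atRecord` — the composed producer at the endpoint's averaging ∕ class (`Node00.avOfRecord F 2 Kt`, `Node00.regMSCoPOfRecord F 2 ν Kt k
  (maxDomT ν.M₁ Z)`), datum `bd k (maxDomT ν.M₁ Z)`, slice `GaugeSlice (pts k Λ) T E3`, base field `ext Ṽ_k`, `k ≤ m + K`, support set `S`.
HONEST SCOPE: composition by name of this lane's landed∕filed twins; (J0′)'s chart and `σ` are HYPOTHESES; no near-flatness is proved; nothing of Bałaban's estimates asserted;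
N12 NOT discharged; K1⁹ NOT closed.
-/

noncomputable section

open Set Metric Filter
open scoped Topology Matrix.Norms.L2Operator

namespace Literature.MathematicalPhysics.QuantumFieldTheory.Balaban1983to89.B15Prop1RealChartFamilyAtGaugeB

open B15Prop1SliceCoordinates (GaugeSlice ιA)
open B15Prop1ChartCalculusSU2 (E3)
open B15Prop1ChartSU2 (su2Chart)
open T4CubeChartGnomonic (SU2)
open T4Continuum B15DeterminingSets B15DeterminingSetsB GaugeField
open T4AdjointCovarianceUnitary (lieSU specialUnitaryAd)
open Node00 (expChart)
open B14.Eq213DetSet B14.Eq216Concrete B14.Eq22Determines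
open B16Sect1Backgrounds (expMul toMS)
open B15Prop1AnalyticExtClause (cplxVec)
open Literature.MathematicalPhysics.QuantumLattice (quatMatrix)
open T4HaarSU2ExpChart (imQuat)
open B15Prop1RealChartFamilyVelocityB (exists_realChartFamily_hval_velocity_atRecordB)
open B15Prop1RealChartFamilySupportB (support_realChartFamily_atRecord)
open B15Prop1RealChartFamilyGaugeTransportB (realChartFamily_gaugeAct_atRecord)
open Literature.MathematicalPhysics.QuantumFieldTheory.BalabanImbrieJaffe1984to88.BIJ85Eq453GaugeField (qsstarGIter0)

variable {F : T4Family}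

/-- ★★★ **THE (K′) PACKAGE AT ANY RESIDUAL GAUGE OF THE BASE MINIMISER, AT THE ENDPOINT'S OBJECTS — BOND-DATUM EDITION.**  From (J0′)'s clauses at one base field `Ṽ_k`
(holomorphic minimiser chart `Ũ` on the ball of radius `R` with the bound `𝓐₀`, real points = (2.12) minimisers over the bond datum `bd k (maxDomT ν.M₁ Z)`) for the Prop-1
instance's averaging ∕ class ∕ slice, with `k ≤ m + K`, the datum empty above level `k` (`hbd`), a displayed support set `S` with `hS : ∀ b ∉ S, b ∈ bd k (maxDomT ν.M₁ Z) 0` and the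
`hfar` clause off `S`: there is a base minimiser `U₀` (for the datum `M˙(Q_k^{s*}(ext Ṽ_k))`) such that FOR EVERY residual gauge transformation `σ` of the constraints (`hu`: trivial on
the block towers under the endpoints of the bonds of the datum, levels `≤ k`) there is a family `X_f^σ` at `σ • U₀` with: `X_f^σ 0 = 0`; `ContDiffAt ℝ 2 X_f^σ 0`; `expChart (σ • U₀)
(X_f^σ Y)` a (2.12) minimiser of `M˙(Q_k^{s*}(exp(i·ιA Y)·ext Ṽ_k))` for `Y` near `0`; the velocity bounds (K) `‖↑(DX_f^σ(0)X(b))‖ ≤ 8𝓐₀∕R·‖X‖` and `‖DX_f^σ(0)X(b)‖ ≤ 12𝓐₀∕R·‖X‖`;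
and the support letter (`X_f^σ Y (b) = 0` near `Y = 0` and `DX_f^σ(0)X(b) = 0` whenever `b ∉ S`).  Composition of the lane's twins of p613674 (family + (K) at `U₀`), p618388
(transport to `σ • U₀`, sizes preserved) and p616516 (support at `σ • U₀`).
[cite: Balaban1985Variational, (3)–(4) p.278, (15) p.280, (172) p.305, (181) p.307, Prop. 9 (190) p.309; Balaban1989LargeFieldII, p.357, (1.12) p.359; Balaban1989LargeFieldI, (1.74) p.192, Prop. 1 p.194 (last clause); Balaban1988Convergent, (2.2) p.255, (2.11)–(2.13) pp.256–257; Balaban1984PropagatorsII, (2.3) p.224] -/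
theorem exists_realChartFamily_atGauge_atRecord (ν : Node00.Stage7Numerics) (Kt : ℕ) {k : ℕ} (hk : k ≤ (F.P Kt).m + (F.P Kt).K)
    (bd : ℕ → (ℕ → Set (Site (F.P Kt) 0)) → BDetSet (F.P Kt)) (Z Λ : Set (Site (F.P Kt) 0)) (hbd : ∀ j, k < j → bd k (maxDomT ν.M₁ Z) j = ∅)
    (T : Finset (PBond (F.P Kt) k))
    (φ : EuclideanSpace ℝ (Fin 3) →ₗ[ℝ] lieSU (Fin 2)) (hφ : ∀ v, ((φ v : lieSU (Fin 2)) : Matrix (Fin 2) (Fin 2) ℂ) = quatMatrix (imQuat v))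
    (ext : GaugeField (F.P Kt) k SU2 → GaugeField (F.P Kt) k SU2) (Vk : GaugeField (F.P Kt) k SU2) {R : ℝ} (hR : 0 < R)
    (Ũ : VecField (F.P Kt) k (EuclideanSpace ℂ (Fin 3)) × VecField (F.P Kt) k (EuclideanSpace ℂ (Fin 3)) → PBond (F.P Kt) 0 → Matrix (Fin 2) (Fin 2) ℂ)
    (hdiff : ∀ b a c, DifferentiableOn ℂ (fun z => Ũ z b a c) (ball 0 R))
    {𝓐₀ : ℝ} (h𝓐 : ∀ z ∈ ball (0 : VecField (F.P Kt) k (EuclideanSpace ℂ (Fin 3)) × VecField (F.P Kt) k (EuclideanSpace ℂ (Fin 3))) R, ∀ b a c, ‖Ũ z b a c‖ ≤ 𝓐₀)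
    (hreal : ∀ p B' : VecField (F.P Kt) k E3, ‖p‖ < R → ‖B'‖ < R → ∃ U' : GaugeField (F.P Kt) 0 SU2,
      (∀ b, Ũ (cplxVec p, cplxVec B') b = ((U' b : SU2) : Matrix (Fin 2) (Fin 2) ℂ)) ∧
        IsMinimizerB (Node00.avOfRecord F 2 Kt) (Node00.regMSCoPOfRecord F 2 ν Kt k (maxDomT ν.M₁ Z)) (bd k (maxDomT ν.M₁ Z))
          (avgFamily (Node00.avOfRecord F 2 Kt) (qsstarGIter0 k (expMul su2Chart B' (ext (expMul su2Chart p Vk))))) U')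
    (S : Set (PBond (F.P Kt) 0)) (hS : ∀ b ∉ S, b ∈ bd k (maxDomT ν.M₁ Z) 0)
    (hfar : ∀ b ∉ S, (⟨blockIter k b.src, b.dir⟩ : PBond (F.P Kt) k) ∉ bondsOf (pts k Λ)) :
    ∃ U₀ : GaugeField (F.P Kt) 0 SU2,
      IsMinimizerB (Node00.avOfRecord F 2 Kt) (Node00.regMSCoPOfRecord F 2 ν Kt k (maxDomT ν.M₁ Z)) (bd k (maxDomT ν.M₁ Z))
        (avgFamily (Node00.avOfRecord F 2 Kt) (qsstarGIter0 k (ext Vk))) U₀ ∧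
      ∀ σ : GaugeTransf (F.P Kt) 0 SU2, (∀ j, j ≤ k → ∀ b ∈ bd k (maxDomT ν.M₁ Z) j, toMS σ j b.src = 1 ∧ toMS σ j b.tgt = 1) →
        ∃ Xf : GaugeSlice (pts k Λ) T E3 → PBond (F.P Kt) 0 → lieSU (Fin 2),
          Xf 0 = 0 ∧ ContDiffAt ℝ 2 Xf 0 ∧
          (∀ᶠ Y in 𝓝 (0 : GaugeSlice (pts k Λ) T E3),
            IsMinimizerB (Node00.avOfRecord F 2 Kt) (Node00.regMSCoPOfRecord F 2 ν Kt k (maxDomT ν.M₁ Z)) (bd k (maxDomT ν.M₁ Z))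
              (avgFamily (Node00.avOfRecord F 2 Kt) (qsstarGIter0 k (expMul su2Chart (ιA (pts k Λ) T Y) (ext Vk)))) (expChart (gaugeAct σ U₀) (Xf Y))) ∧
          (∀ (X : GaugeSlice (pts k Λ) T E3) (b : PBond (F.P Kt) 0),
            ‖((fderiv ℝ Xf 0 X b : lieSU (Fin 2)) : Matrix (Fin 2) (Fin 2) ℂ)‖ ≤ 8 * 𝓐₀ / R * ‖X‖ ∧ ‖fderiv ℝ Xf 0 X b‖ ≤ 12 * 𝓐₀ / R * ‖X‖) ∧
          (∀ᶠ Y in 𝓝 (0 : GaugeSlice (pts k Λ) T E3), ∀ b ∉ S, Xf Y b = 0) ∧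
          ∀ (X : GaugeSlice (pts k Λ) T E3), ∀ b ∉ S, fderiv ℝ Xf 0 X b = 0 := by
  obtain ⟨U₀, Xf, hX₀, hXc, -, -, -, hmin0, hmin, -, hK⟩ :=
    exists_realChartFamily_hval_velocity_atRecordB ν Kt k (maxDomT ν.M₁ Z) ν.M₁ bd Z (pts k Λ) T φ hφ ext Vk hR Ũ hdiff h𝓐 hreal
  refine ⟨U₀, hmin0, fun σ hu => ?_⟩
  obtain ⟨h0, hc, hm, hvel⟩ := realChartFamily_gaugeAct_atRecord ν Kt hk (bd k (maxDomT ν.M₁ Z)) Z Λ hbd T ext Vk σ hu U₀ Xf hX₀ hXc hmin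
  have h0' : (fun Y b => specialUnitaryAd (σ b.tgt) (Xf Y b)) 0 = 0 := h0
  obtain ⟨hsuppY, hsuppD⟩ := support_realChartFamily_atRecord ν Kt hk (bd k (maxDomT ν.M₁ Z)) Z Λ T ext Vk S hS hfar (gaugeAct σ U₀)
    (fun Y b => specialUnitaryAd (σ b.tgt) (Xf Y b)) h0' hc.continuousAt hm
  refine ⟨fun Y b => specialUnitaryAd (σ b.tgt) (Xf Y b), h0', hc, hm, fun X b => ?_, hsuppY, hsuppD⟩
  obtain ⟨-, hHS, hop, -⟩ := hvel X b
  exact ⟨hop ▸ (hK X b).1, hHS ▸ (hK X b).2⟩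

end Literature.MathematicalPhysics.QuantumFieldTheory.Balaban1983to89.B15Prop1RealChartFamilyAtGaugeB

end
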